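import Mathlib
import Literature.NumberTheory.LFunctions.Zhang2022.AppendixALemma161Steps
import Literature.NumberTheory.LFunctions.Zhang2022.Section16Lemma162RLocal
import HarnessLib

/-!
# Zhang (2022) §16 / App. A p. 105: closed forms at a prime for the local data of Lemma 16.2 —
# `F_q(d,l;s)` for ALL `(d,l)`, and `(ν∗χ)(q^e)` for `χ(q) = ±1` (WP09-PLAN §10.3, D-2e preparation)

Topic `Literature/NumberTheory/LFunctions/Zhang2022` (Landau–Siegel audit tree; verdict-neutral).
Y. Zhang, *Discrete mean estimates and the Landau–Siegel zero*, arXiv:2211.02515v1 (2022)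
[Zhang2022LandauSiegel] — **an unrefereed manuscript under adjudication; nothing here asserts or
denies its Theorems 1–2 or anything about Landau–Siegel zeros.** ZHANG-L discharge lane, WP16
BLOCK D (Lemma 16.2, row G-d57-1; carve of record: zl-w09-p6 = "the prime 2"), preparation for item
D-2e of WP09-PLAN §10.3 (the value of the `2`-factor at `s = 1`): the two closed forms every per-prime
value computation uses, stated for a general prime `q` (so zl-w09-p4's per-prime part may cite them too).

* `calM2Factor_prime_eq` — **the Euler factor `F_q(d,l;s)` of `𝓜₂(d,l;s)` in closed form for every
  `d, l`** (`‖q^{−s}‖ < 1`): `F_q = P(v,w,x)·(1 + Λ_d·Σ_{d,l})` with `v = χ(q)`, `w = q^{−β₁}`,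
  `x = q^{−s}`, `P = (1−wx)/((1−x)(1−vx))` (`AppendixA.locPref`), `Λ_d = λ₂(q)` (`AppendixA.locLam`) if
  `q ∤ d` else `1` (`AppendixA.lamTilde2_prime`), and `Σ_{d,l}` the closed form of the local series
  `AppendixA.xi2LocalSeries_prime` (depends on `d, l` only through `q ∣ d`, `q ∣ l`). The tree had the
  case `d = l = 1` (`AppendixA.calM2Factor_prime_one_one`).
* `nuConvChi_prime_pow_of_apply_eq_one` — `χ(q) = 1 ⇒ (ν∗χ)(q^e) = C(e+2, 2)`;
  `nuConvChi_prime_pow_of_apply_eq_neg_one` — `χ(q) = −1 ⇒ (ν∗χ)(q^e) = (−1)^e(⌊e/2⌋ + 1)`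
  (`ν(q^i) = Σ_{k≤i}χ(q)^k`; the case `χ(q) = 0` is zl-w09-p4's `Lemma162R.nuConvChi_prime_pow_of_apply_eq_zero`).

Theorem-only; no definitions, no new facts; (A) is not used.

## References

* Y. Zhang, arXiv:2211.02515v1 (2022), §16 pp. 91–94 (u021, u026, (16.15)), App. A p. 105.
  [cite: Zhang2022LandauSiegel, §16 p.91 (u021); App. A p.105]
-/

noncomputable section

open Complex Real Finset

namespace Literature.NumberTheory.LFunctions.Zhang2022.Typed.Section16B

open Literature.NumberTheory.LFunctions.Zhang2022
open Literature.NumberTheory.LFunctions.Zhang2022.Skeleton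
open Literature.NumberTheory.LFunctions.Zhang2022.Typed.Section16A

variable (c' : ℝ) {D : ℕ} (χ : DirichletCharacter ℂ D)

/-! ## The Euler factor `F_q(d,l;s)` in closed form -/

/-- **`F_q(d,l;s)` in closed form, every `d, l`** (`q` prime, `‖q^{−s}‖ < 1`): with `v = χ(q)`,
`w = q^{−β₁}`, `x = q^{−s}`:
`F_q(d,l;s) = (1−wx)/((1−x)(1−vx)) · (1 + Λ_d · (c_d(w−1)x/(1−wx) − [q∤l]·(vq/(q−1))·x(1−x)/(1−wx)))`,
`Λ_d = λ₂(q) = (1−vw/q)/(1−v/q)` and `c_d = (1−wv/q)⁻¹` if `q ∤ d`, `Λ_d = c_d = 1` if `q ∣ d`.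
[cite: Zhang2022LandauSiegel, §16 p.91 (u021); App. A p.105] -/
theorem calM2Factor_prime_eq {q : ℕ} (hq : q.Prime) (d l : ℕ) (s : ℂ) (hx : ‖(q : ℂ) ^ (-s)‖ < 1) :
    calM2Factor c' χ q d l s =
      AppendixA.locPref (χ (q : ZMod D)) ((q : ℂ) ^ (-beta1 c' D)) ((q : ℂ) ^ (-s)) *
        (1 + (if Nat.Coprime q d then
                AppendixA.locLam (χ (q : ZMod D)) ((q : ℂ) ^ (-beta1 c' D)) q else 1) *
          ((if Nat.Coprime q d then
              (1 - (q : ℂ) ^ (-beta1 c' D) * (χ (q : ZMod D) / q))⁻¹ else 1) *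
              ((q : ℂ) ^ (-beta1 c' D) - 1) * (q : ℂ) ^ (-s) /
              (1 - (q : ℂ) ^ (-beta1 c' D) * (q : ℂ) ^ (-s)) -
            (if Nat.Coprime q l then (1 : ℂ) else 0) * (χ (q : ZMod D) * q / ((q : ℂ) - 1)) *
              ((q : ℂ) ^ (-s) * (1 - (q : ℂ) ^ (-s)) /
                (1 - (q : ℂ) ^ (-beta1 c' D) * (q : ℂ) ^ (-s))))) := by
  have hq0 : (q : ℂ) ≠ 0 := by exact_mod_cast hq.ne_zero
  unfold calM2Factor AppendixA.locPref
  rw [AppendixA.xi2LocalSeries_prime c' χ hq d l s hx, AppendixA.lamTilde2_prime c' χ hq d,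
    neg_add, Complex.cpow_add _ _ hq0]
  ring

/-! ## `(ν∗χ)(q^e)` for `χ(q) = ±1` -/

omit c' in
/-- `ν(q^i) = Σ_{k ≤ i} χ(q)^k`; for `χ(q) = 1` this is `i + 1`. [cite: Zhang2022LandauSiegel, §3 p.12] -/
theorem nu_prime_pow_of_apply_eq_one {q : ℕ} (hq : q.Prime) (hv : χ (q : ZMod D) = 1) (i : ℕ) :
    nu χ (q ^ i) = (i : ℂ) + 1 := by
  rw [nu, Literature.NumberTheory.LFunctions.divisorSumChar_prime_pow χ hq,
    Literature.NumberTheory.LFunctions.geomPartialSum, hv]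
  simp

omit c' in
/-- `ν(q^i) = Σ_{k ≤ i} χ(q)^k`; for `χ(q) = −1` this is `1` for even `i`, `0` for odd `i`.
[cite: Zhang2022LandauSiegel, §3 p.12] -/
theorem nu_prime_pow_of_apply_eq_neg_one {q : ℕ} (hq : q.Prime) (hv : χ (q : ZMod D) = -1) (i : ℕ) :
    nu χ (q ^ i) = if Even i then 1 else 0 := by
  rw [nu, Literature.NumberTheory.LFunctions.divisorSumChar_prime_pow χ hq,
    Literature.NumberTheory.LFunctions.geomPartialSum, hv]
  induction i with
  | zero => simp
  | succ n ih =>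
    rw [Finset.sum_range_succ, ih]
    rcases Nat.even_or_odd n with hn | hn
    · rw [if_pos hn, if_neg (Nat.not_even_iff_odd.mpr hn.add_one), hn.add_one.neg_one_pow]; ring
    · rw [if_neg (Nat.not_even_iff_odd.mpr hn), if_pos hn.add_one, hn.add_one.neg_one_pow]; ring

omit c' in
/-- The recurrence `(ν∗χ)(q^{e+1}) = χ(q)·(ν∗χ)(q^e) + ν(q^{e+1})`. [cite: Zhang2022LandauSiegel, §16 (16.15) p.94] -/
theorem nuConvChi_prime_pow_succ {q : ℕ} (hq : q.Prime) (e : ℕ) :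
    nuConvChi χ (q ^ (e + 1)) = χ (q : ZMod D) * nuConvChi χ (q ^ e) + nu χ (q ^ (e + 1)) := by
  rw [Lemma162R.nuConvChi_prime_pow χ hq (e + 1), Lemma162R.nuConvChi_prime_pow χ hq e,
    Finset.sum_range_succ, Nat.sub_self, pow_zero, mul_one, Finset.mul_sum]
  congr 1
  refine Finset.sum_congr rfl fun i hi => ?_
  have hi' : i ≤ e := Nat.lt_succ_iff.mp (Finset.mem_range.mp hi)
  rw [show e + 1 - i = (e - i) + 1 by omega, pow_succ]
  ring

omit c' in
/-- **`χ(q) = 1 ⇒ (ν∗χ)(q^e) = C(e+2,2) = (e+1)(e+2)/2`** (`ν(q^i) = i+1`).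
[cite: Zhang2022LandauSiegel, §16 (16.15) p.94] -/
theorem nuConvChi_prime_pow_of_apply_eq_one {q : ℕ} (hq : q.Prime) (hv : χ (q : ZMod D) = 1) (e : ℕ) :
    nuConvChi χ (q ^ e) = (((e + 2).choose 2 : ℕ) : ℂ) := by
  induction e with
  | zero => rw [pow_zero, Lemma162R.nuConvChi_one]; norm_num
  | succ n ih =>
    rw [nuConvChi_prime_pow_succ χ hq n, ih, hv, one_mul, nu_prime_pow_of_apply_eq_one χ hq hv,
      show n + 1 + 2 = (n + 2) + 1 by ring, Nat.choose_succ_succ (n + 2) 1, Nat.choose_one_right]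
    push_cast
    ring

omit c' in
/-- **`χ(q) = −1 ⇒ (ν∗χ)(q^e) = (−1)^e(⌊e/2⌋ + 1)`** (`ν(q^i) = [i even]`).
[cite: Zhang2022LandauSiegel, §16 (16.15) p.94] -/
theorem nuConvChi_prime_pow_of_apply_eq_neg_one {q : ℕ} (hq : q.Prime) (hv : χ (q : ZMod D) = -1)
    (e : ℕ) : nuConvChi χ (q ^ e) = (-1) ^ e * (((e / 2 : ℕ) : ℂ) + 1) := by
  induction e with
  | zero => rw [pow_zero, Lemma162R.nuConvChi_one]; norm_num
  | succ n ih =>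
    rw [nuConvChi_prime_pow_succ χ hq n, ih, hv, nu_prime_pow_of_apply_eq_neg_one χ hq hv]
    rcases Nat.even_or_odd n with hn | hn
    · -- `n = 2m`: `(n+1)/2 = m = n/2`, `ν(q^{n+1}) = 0`
      obtain ⟨m, rfl⟩ := hn
      have h1 : (m + m + 1) / 2 = m := by omega
      have h2 : (m + m) / 2 = m := by omega
      rw [if_neg (by rw [Nat.not_even_iff_odd]; exact ⟨m, by ring⟩), h1, h2, pow_succ]
      ring
    · -- `n = 2m+1`: `(n+1)/2 = m+1`, `n/2 = m`, `ν(q^{n+1}) = 1`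
      obtain ⟨m, rfl⟩ := hn
      have h1 : (2 * m + 1 + 1) / 2 = m + 1 := by omega
      have h2 : (2 * m + 1) / 2 = m := by omega
      have h3 : ((-1 : ℂ)) ^ (2 * m + 1) = -1 := by rw [pow_succ, pow_mul]; norm_num
      have h4 : ((-1 : ℂ)) ^ (2 * m + 1 + 1) = 1 := by rw [pow_succ, h3]; norm_num
      rw [if_pos ⟨m + 1, by ring⟩, h1, h2, h4, h3]
      push_cast
      ring

end Literature.NumberTheory.LFunctions.Zhang2022.Typed.Section16B

end
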